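import Literature.NumberTheory.EllipticCurves.CastellaGrossiLeeSkinner2022.HowardDivisibilityAnyClassNumber
import Literature.NumberTheory.EllipticCurves.Rank1Residual.Predicates
import HarnessLib

/-!
# Sketch — crux idea `kolyvagin-h0-budget-two` (crux-ideate u1, lens TRANSFER, round 3, seat 3 g0)

Crux O2 = `…Theorems.TwoAdicKatoDeterminant.BDPSelmerLowerDivisibilityAtTwo` (item
stmt-BirchSwinnertonDyer-24728). First lemma of the transferred line: the `p = 2`, habitat-(β)
port of Castella–Grossi–Lee–Skinner 2022 Thm. 4.1.3 (tree fact
`CastellaGrossiLeeSkinner2022.thm413_rankOne_charIdeal_torsion_dvd_localized`, binders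
`Thm413Hypotheses` with `p_ne_two` and `noPTorsion` = (h1) `E(K)[p] = 0`), with (h1) — which fails for
EVERY `G_K`-stable lattice of `V₂E` on (β) — replaced by nothing: the claim is that the 2-power slack
`2^m` (the tree's "light frame" currency of PrintX9) absorbs the `H⁰`-error budget. Typed over existing
declarations only; defs + one kernel-checked consumption seam; no `sorry`.
-/

namespace Summit.BirchSwinnertonDyer.BirchSwinnertonDyer.Cruxes.BDPSelmerLowerDivisibilityAtTwo.KolyvaginH0BudgetTwo

open scoped Classical
open WeierstrassCurve PowerSeries
open Literature.NumberTheory.EllipticCurves Literature.NumberTheory.EllipticCurves.Rank1Residual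
open Literature.NumberTheory.EllipticCurves.CastellaGrossiLeeSkinner2022

instance : Fact (Nat.Prime 2) := ⟨Nat.prime_two⟩

/-- **K1 (first lemma, crux-rank 2) `KolyvaginLightAtTwoBeta`** — CGLS 2022 Thm. 4.1.3 (i)+(ii) and its
"Moreover" clause PORTED to `p = 2` on habitat (β): for `E/ℚ` non-CM, good ordinary at `2`, `E[2]`
reducible, `K` imaginary quadratic with the Heegner hypothesis for `2N` (so `2 = v v̄` splits and `d_K`
is odd, `≠ -3, -4`), `κ` the anticyclotomic `ℤ₂`-extension with topological generator `γ`, every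
`Λ`-adic Selmer datum `D = 𝔖`, `α`-stabilised `d(k)`-shifted Heegner datum `C` (`Λκ_∞`) and Selmer-dual
datum `X = 𝔛`: `char_Λ(𝔛_{Λ-tors}) ∣ (2^m)·(T^n)·I(Λκ_∞)²` for some `m n`, and at `ℤ₂`-corank one
`char_Λ(𝔛_{Λ-tors}) ∣ (2^m')·I(Λκ_∞)²` — NO hypothesis (h1) (it is false for every lattice here), NO
image hypothesis beyond non-CM. The squared shape (not `= J²`) is deliberate: the `M ⊕ M` structure at
`2` is not claimed. -/
def KolyvaginLightAtTwoBeta : Prop :=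
  ∀ (W : WeierstrassCurve ℚ) [W.IsElliptic] [W.IsGloballyMinimal] [NeZero (W.conductorNorm ℤ)],
    ¬ W.HasCM → GoodOrd W 2 → ¬ W.HasIrreducibleModPGaloisRep 2 →
    ∀ (K : Type) [Field K] [NumberField K] (κ : ZpExtension K 2) (γ : Field.absoluteGaloisGroup K)
      (jbar : AlgebraicClosure K →+* ℂ),
      (IsImaginaryQuadratic K ∧ SatisfiesHeegnerHypothesis (2 * W.conductorNorm ℤ) K) →
      κ.IsAnticyclotomic → κ.IsTopGenerator γ →
      ∀ (D : (W.baseChange K).LambdaAdicSelmerData κ γ)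
        (C : StabilizedHeegnerData (W.conductorNorm ℤ) W K κ jbar)
        (X : (W.baseChange K).SelmerDualData κ γ),
        (∃ m n : ℕ, Module.charIdeal (IwasawaAlgebra 2) (Submodule.torsion (IwasawaAlgebra 2) X.X) ∣
            Ideal.span {(2 : IwasawaAlgebra 2) ^ m} * Ideal.span {(PowerSeries.X : IwasawaAlgebra 2) ^ n} *
              stabilizedHeegnerCharIdeal D C ^ 2) ∧
        ((W.baseChange K).selmerCorank 2 = 1 →
          ∃ m' : ℕ, Module.charIdeal (IwasawaAlgebra 2) (Submodule.torsion (IwasawaAlgebra 2) X.X) ∣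
            Ideal.span {(2 : IwasawaAlgebra 2) ^ m'} * stabilizedHeegnerCharIdeal D C ^ 2)

/-- **K1♭ (the bounded-error single statement the Λ-adic induction specialises)** — the `H⁰`-budget
itself, as the transferred replacement of CGLS Lemma 3.3.2 / Mazur–Rubin Lemma 3.5.4: over the whole
anticyclotomic tower the `2`-primary torsion of `E` is FINITE (non-CM `E`: open `2`-adic image meets the
pro-dihedral `Gal(K_∞/ℚ)` in a finite quotient), so ONE exponent `e₀` kills `E(K_n)[2^∞]` for every
layer `n`. Typed with the tree's fixed-field predicate: every `2^k`-torsion point fixed by `Gal(K̄/K_n)`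
is killed by `2^{e₀}`, uniformly in `n` and `k`. -/
def TowerTorsionBudgetAtTwo : Prop :=
  ∀ (W : WeierstrassCurve ℚ) [W.IsElliptic] [W.IsGloballyMinimal], ¬ W.HasCM →
    ∀ (K : Type) [Field K] [NumberField K] (κ : ZpExtension K 2),
      IsImaginaryQuadratic K → κ.IsAnticyclotomic →
      ∃ e₀ : ℕ, ∀ (n : ℕ) (Q : geomPoints (W.baseChange K)),
        (∃ k : ℕ, ((2 : ℤ) ^ k) • Q = 0) → (∀ σ ∈ κ.layerSubgroup n, σ • Q = Q) → ((2 : ℤ) ^ e₀) • Q = 0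

/-- **Consumption seam (kernel-checked): how K1 is used by the rank-one `2`-converse on (β).**
In `Λ = ℤ₂⟦T⟧`: if the Heegner index ideal `I` and an ideal `J` divide each other up to powers of `2`
(K1's corank-one clause gives `J ∣ 2^{m}·I²`-type control; the λ-MATCHING half of LINK B♭ gives the
reverse `I² ∣ 2^{m'}·J`), then `J ⊄ (T)` forces `I² ⊄ (T)` — i.e. "corank one ⟹ `𝔛_tors` has no
`(γ-1)`-factor ⟹ `I(Λκ_∞)(𝟙) ≠ 0` ⟹ `κ₁ ≠ 0`", the zero-forcing step, with the `2`-powers provably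
harmless because `(T)` is prime and `2^{m'} ∉ (T)`. Pure algebra; this is the reason the LIGHT (2-power
slack) currency suffices for the converse and `μ` at `2` never enters. -/
theorem not_le_spanX_of_dvd_pow_mul {I J : Ideal (IwasawaAlgebra 2)} {m' : ℕ}
    (hrev : I ∣ Ideal.span {(2 : IwasawaAlgebra 2) ^ m'} * J)
    (hJ : ¬ J ≤ Ideal.span {(PowerSeries.X : IwasawaAlgebra 2)}) :
    ¬ I ≤ Ideal.span {(PowerSeries.X : IwasawaAlgebra 2)} := by
  intro hI
  apply hJ
  have hP : (Ideal.span {(PowerSeries.X : IwasawaAlgebra 2)}).IsPrime := PowerSeries.span_X_isPrime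
  have hle : Ideal.span {(2 : IwasawaAlgebra 2) ^ m'} * J ≤ Ideal.span {(PowerSeries.X : IwasawaAlgebra 2)} :=
    le_trans (Ideal.le_of_dvd hrev) hI
  have h2 : ¬ Ideal.span {(2 : IwasawaAlgebra 2) ^ m'} ≤ Ideal.span {(PowerSeries.X : IwasawaAlgebra 2)} := by
    intro h
    have hmem : (2 : IwasawaAlgebra 2) ^ m' ∈ Ideal.span {(PowerSeries.X : IwasawaAlgebra 2)} :=
      h (Ideal.mem_span_singleton_self _)
    rw [Ideal.mem_span_singleton] at hmem
    obtain ⟨c, hc⟩ := hmem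
    have h0 := congrArg (PowerSeries.constantCoeff (R := ℤ_[2])) hc
    simp only [map_pow, map_mul, PowerSeries.constantCoeff_X, zero_mul, map_ofNat] at h0
    exact pow_ne_zero m' two_ne_zero h0
  exact (hP.mul_le.mp hle).resolve_left h2

end Summit.BirchSwinnertonDyer.BirchSwinnertonDyer.Cruxes.BDPSelmerLowerDivisibilityAtTwo.KolyvaginH0BudgetTwo
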